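import Summits.CriticalPhenomena.PercolationContinuityZ3.Theorems.PercNearOneGluingNoHeavyLowerTailApexTwoSumSums
import Summits.CriticalPhenomena.PercolationContinuityZ3.Theorems.PercNearOneGluingNoHeavyLowerTailNetworkFoldGlue
import HarnessLib

/-!
# `NoHeavyLowerTail` (stmt-CriticalPhenomena-4575) — the 1|1|1 hub pair (Θ-graphs), part 1:
# symmetry of the arm cells under swapping the hubs, and the `{h₁,h₂}`-WIRED cells of two terminal arms in parallel

Support file (prover prim-gen-kcluster gen 72; `--supports stmt-CriticalPhenomena-4575`).  No definitions, no named facts, no sorries.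
SE({h₁, h₂} : Set V)ING (KCLUSTER-gen65 §1–2, here at the measure level): two TERMINAL ARMS `DB ∋ b`, `DC ∋ c` meeting only in the hubs `h₁ ≠ h₂`
(`b` on no pair of `DC`, `c` on no pair of `DB`); `w` vanishing off `DB ∪ DC`, `wB = w·1_{DB}`, `wC = w·1_{DBᶜ}`; `T = {h₁, h₂}`, `K = q^{k^T(∅)}`.
This is the setting of `…ApexTwoSum*` with apex `h₁` and hub `h₂` (or the other way round).
* `ThetaFar.cellA_symm … cellE_symm` — the arm cells at apex `h₂` are the arm cells at apex `h₁` with `C ↔ D` (pure cluster algebra);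
* `ThetaFar.glued_bT_iff`, `glued_cT_iff` — `b ~ T` in the glued configuration iff in its own arm; `sep_wired` — `C(h₁) ∪ C(h₂)` always separates
  `b` from `c` in `DB ∪ DC`;
* `ThetaFar.wired_T_sum`, `_Ub_`, `_Uc_`, `_S_sum` — the `T`-wired masses of the wired cells of `DB ∪ DC` are PRODUCTS:
  `K·Z_w(T*) = x_b y_c`, `K·Z_w(U_b*) = x_b y_c'`, `K·Z_w(U_c*) = x_b' y_c`, `K·Z_w(S*) = x_b' y_c'` (`x_b = R_B(b ~ T)`, `x_b' = R_B(b ≁ T)`, …);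
  `xT_split`, `xT'_split` — `x_b = X_A + X_C + X_D`, `x_b' = X_B + X_E` in the arm cells.
Part 2 (`…ThetaFarRows`) derives the six far-side rows of `HubPairApex.r1_of_far_side` for `DB ∪ DC` from R1 and FKG on the arms
(gen 65's kernel certificates `ThetaBlocks.CROSS_cert / W0_cert / W1_cert`), part 3 (`…ThetaR1`) concludes R1 on every Θ-graph.
-/

noncomputable section

namespace Summit.CriticalPhenomena.PercolationContinuityZ3.Theorems

namespace ThetaFar

open Finset SimpleGraph Literature.Probability.Percolation Literature.Probability.Percolation.Gladkov
open Literature.Probability.Percolation.BHK2006 (weight)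
open Literature.Probability.Percolation.DecisionTree (ind ind_of_mem ind_of_not_mem ind_nonneg)
open Literature.Probability.LatticeModels RefinedRowR3 ThreePointLB APL MeasureTheory
open scoped Classical

variable {V : Type*} [Fintype V]

/-! ### Swapping the hubs in the arm cells -/

section Symm

variable (t u v : V)

/-- `A`-cell: all three joined — symmetric in the hubs. [folklore] -/
theorem cellA_symm : {η : BondConfig V | t ∈ cl η.toFinset u ∧ v ∈ cl η.toFinset u} =
    {η : BondConfig V | t ∈ cl η.toFinset v ∧ u ∈ cl η.toFinset v} := by
  ext η; simp only [Set.mem_setOf_eq]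
  constructor
  · rintro ⟨h1, h2⟩; exact ⟨mem_cl_trans (mem_cl_comm.1 h2) h1, mem_cl_comm.1 h2⟩
  · rintro ⟨h1, h2⟩; exact ⟨mem_cl_trans (mem_cl_comm.1 h2) h1, mem_cl_comm.1 h2⟩

/-- `B`-cell: hubs joined, terminal apart — symmetric in the hubs. [folklore] -/
theorem cellB_symm : {η : BondConfig V | t ∉ cl η.toFinset u ∧ v ∈ cl η.toFinset u} =
    {η : BondConfig V | t ∉ cl η.toFinset v ∧ u ∈ cl η.toFinset v} := by
  ext η; simp only [Set.mem_setOf_eq]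
  constructor
  · rintro ⟨h1, h2⟩; exact ⟨fun h => h1 (mem_cl_trans h2 h), mem_cl_comm.1 h2⟩
  · rintro ⟨h1, h2⟩; exact ⟨fun h => h1 (mem_cl_trans h2 h), mem_cl_comm.1 h2⟩

/-- `C`-cell at apex `u` = `D`-cell at apex `v`. [folklore] -/
theorem cellC_symm : {η : BondConfig V | t ∈ cl η.toFinset u ∧ v ∉ cl η.toFinset u} =
    {η : BondConfig V | t ∉ cl η.toFinset v ∧ u ∉ cl η.toFinset v ∧ u ∈ cl η.toFinset t} := by
  ext η; simp only [Set.mem_setOf_eq]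
  constructor
  · rintro ⟨h1, h2⟩
    exact ⟨fun h => h2 (mem_cl_trans h1 (mem_cl_comm.1 h)), fun h => h2 (mem_cl_comm.1 h), mem_cl_comm.1 h1⟩
  · rintro ⟨-, h2, h3⟩
    exact ⟨mem_cl_comm.1 h3, fun h => h2 (mem_cl_comm.1 h)⟩

/-- `D`-cell at apex `u` = `C`-cell at apex `v`. [folklore] -/
theorem cellD_symm : {η : BondConfig V | t ∉ cl η.toFinset u ∧ v ∉ cl η.toFinset u ∧ v ∈ cl η.toFinset t} =
    {η : BondConfig V | t ∈ cl η.toFinset v ∧ u ∉ cl η.toFinset v} := by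
  rw [cellC_symm t v u]

/-- `E`-cell: all apart — symmetric in the hubs. [folklore] -/
theorem cellE_symm : {η : BondConfig V | t ∉ cl η.toFinset u ∧ v ∉ cl η.toFinset u ∧ v ∉ cl η.toFinset t} =
    {η : BondConfig V | t ∉ cl η.toFinset v ∧ u ∉ cl η.toFinset v ∧ u ∉ cl η.toFinset t} := by
  ext η; simp only [Set.mem_setOf_eq]
  constructor
  · rintro ⟨h1, h2, h3⟩; exact ⟨fun h => h3 (mem_cl_comm.1 h), fun h => h2 (mem_cl_comm.1 h), fun h => h1 (mem_cl_comm.1 h)⟩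
  · rintro ⟨h1, h2, h3⟩; exact ⟨fun h => h3 (mem_cl_comm.1 h), fun h => h2 (mem_cl_comm.1 h), fun h => h1 (mem_cl_comm.1 h)⟩

end Symm

/-! ### The wired cells of two terminal arms in parallel -/

section Wired

variable {DB DC : Finset (Sym2 V)} {h₁ h₂ b c : V} (h12 : h₁ ≠ h₂) (h1b : h₁ ≠ b) (h1c : h₁ ≠ c) (h2b : h₂ ≠ b) (h2c : h₂ ≠ c)
  (hsep : ∀ z : V, (∃ e ∈ DB, z ∈ e) → (∃ e ∈ DC, z ∈ e) → (z = h₁ ∨ z = h₂))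
  (hbC : ∀ e ∈ DC, b ∉ e) (hcB : ∀ e ∈ DB, c ∉ e)

include h1b h2b hsep hbC in
/-- `b ~ {h₁,h₂}` in the glued configuration iff in its own arm. [this work] -/
theorem glued_bT_iff {ω : BondConfig V} (hω : ω ⊆ ↑DB ∪ ↑DC) :
    (b ∈ cl ω.toFinset h₁ ∨ b ∈ cl ω.toFinset h₂) ↔ (ω ∩ ↑DB) ∈ {η : BondConfig V | (b ∈ cl η.toFinset h₁ ∨ b ∈ cl η.toFinset h₂)} := by
  have hsep' : ∀ z : V, (∃ e ∈ DB, z ∈ e) → (∃ e ∈ DC, z ∈ e) → (z = h₂ ∨ z = h₁) := fun z h1 h2 => (hsep z h1 h2).symm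
  have e1 := ApexTwoSum.glued_b_iff h1b hsep hbC hω
  have e2 := ApexTwoSum.glued_b_iff h2b hsep' hbC hω
  simp only [Set.mem_setOf_eq] at e1 e2 ⊢
  rw [e1, e2]
  constructor
  · rintro ((h | ⟨h, -⟩) | (h | ⟨h, -⟩))
    · exact Or.inl h
    · exact Or.inr (mem_cl_comm.1 h)
    · exact Or.inr h
    · exact Or.inl (mem_cl_comm.1 h)
  · rintro (h | h)
    · exact Or.inl (Or.inl h)
    · exact Or.inr (Or.inl h)

include h1c h2c hsep hcB in
/-- `c ~ {h₁,h₂}` in the glued configuration iff in its own arm. [this work] -/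
theorem glued_cT_iff {ω : BondConfig V} (hω : ω ⊆ ↑DB ∪ ↑DC) :
    (c ∈ cl ω.toFinset h₁ ∨ c ∈ cl ω.toFinset h₂) ↔ (ω \ ↑DB) ∈ {η : BondConfig V | (c ∈ cl η.toFinset h₁ ∨ c ∈ cl η.toFinset h₂)} := by
  have hsep' : ∀ z : V, (∃ e ∈ DB, z ∈ e) → (∃ e ∈ DC, z ∈ e) → (z = h₂ ∨ z = h₁) := fun z h1 h2 => (hsep z h1 h2).symm
  have e1 := ApexTwoSum.glued_c_iff h1c hsep hcB hω
  have e2 := ApexTwoSum.glued_c_iff h2c hsep' hcB hω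
  simp only [Set.mem_setOf_eq] at e1 e2 ⊢
  rw [e1, e2]
  constructor
  · rintro ((h | ⟨h, -⟩) | (h | ⟨h, -⟩))
    · exact Or.inl h
    · exact Or.inr (mem_cl_comm.1 h)
    · exact Or.inr h
    · exact Or.inl (mem_cl_comm.1 h)
  · rintro (h | h)
    · exact Or.inl (Or.inl h)
    · exact Or.inr (Or.inl h)

include h1b h2b h1c h2c hsep hbC hcB in
/-- **`C(h₁) ∪ C(h₂)` separates `b` from `c` in `DB ∪ DC`**, for every configuration. [this work] -/
theorem sep_wired (hbc : b ≠ c) (ω : BondConfig V) : Sep (DB ∪ DC) (cl ω.toFinset h₁ ∪ cl ω.toFinset h₂) b c := by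
  unfold RefinedRowR3.Sep
  set W := cl ω.toFinset h₁ ∪ cl ω.toFinset h₂ with hW
  have h1W : h₁ ∈ W := Finset.mem_union_left _ (mem_cl_self _ _)
  have h2W : h₂ ∈ W := Finset.mem_union_right _ (mem_cl_self _ _)
  intro hcb
  rw [Finset.union_sdiff_distrib, Finset.union_comm] at hcb
  -- the network `DC ∖ touch W` (poles `h₁, h₂`, both on no surviving pair) glued to `DB ∖ touch W`, apex `b`
  have hpole : ∀ t, t ∈ W → t ≠ b → t ∉ cl ((DC \ touch W) ∪ (DB \ touch W)) b := by
    intro t ht htb h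
    obtain ⟨e, he, hte⟩ := exists_mem_edge_of_mem_cl h htb
    rcases Finset.mem_union.1 he with he | he <;>
      exact (Finset.mem_sdiff.1 he).2 (mem_touch.2 ⟨t, ht, hte⟩)
  have key := NetworkFold.not_inner_of_mem_cl (ζX := DC \ touch W) (ζY := DB \ touch W) (u := h₁) (v := h₂) (a := b)
    (fun z ⟨e, he, hze⟩ ⟨f, hf, hzf⟩ => hsep z ⟨f, (Finset.mem_sdiff.1 hf).1, hzf⟩ ⟨e, (Finset.mem_sdiff.1 he).1, hze⟩)
    (fun e he hbe => absurd hbe (hbC e (Finset.mem_sdiff.1 he).1))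
    (hpole h₁ h1W h1b) (hpole h₂ h2W h2b) hcb
  obtain ⟨e, he, hce⟩ := exists_mem_edge_of_mem_cl hcb hbc.symm
  rcases Finset.mem_union.1 he with he | he
  · rcases key e he hce with h | h
    · exact h1c h.symm
    · exact h2c h.symm
  · exact hcB e (Finset.mem_sdiff.1 he).1 hce

end Wired

section WiredSums

variable {DB DC : Finset (Sym2 V)} {h₁ h₂ b c : V} (h12 : h₁ ≠ h₂) (h1b : h₁ ≠ b) (h1c : h₁ ≠ c) (h2b : h₂ ≠ b) (h2c : h₂ ≠ c) (hbc : b ≠ c)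
  (hsep : ∀ z : V, (∃ e ∈ DB, z ∈ e) → (∃ e ∈ DC, z ∈ e) → (z = h₁ ∨ z = h₂))
  (hbC : ∀ e ∈ DC, b ∉ e) (hcB : ∀ e ∈ DB, c ∉ e)
  (w wB wC : Sym2 V → unitInterval) (q : ℝ) (hw : ∀ e, e ∉ (↑DB ∪ ↑DC : Set (Sym2 V)) → (w e : ℝ) = 0)
  (hX : ∀ e ∈ (↑DB : Set (Sym2 V)), wB e = w e) (hX' : ∀ e ∉ (↑DB : Set (Sym2 V)), wB e = 0)
  (hY : ∀ e ∈ (↑DB : Set (Sym2 V)), wC e = 0) (hY' : ∀ e ∉ (↑DB : Set (Sym2 V)), wC e = w e)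

include hsep hw in
/-- **Wired pointwise identity** for a product event. [this work] -/
theorem wired_pt {E EX EY : Set (BondConfig V)}
    (hE : ∀ ω : BondConfig V, ω ⊆ ↑DB ∪ ↑DC → (ω ∈ E ↔ ((ω ∩ ↑DB) ∈ EX ∧ (ω \ ↑DB) ∈ EY))) (ω : BondConfig V) :
    rcWeightW w q ({h₁, h₂} : Set V) ω * ind E ω * q ^ clusterCount (∅ : BondConfig V) ({h₁, h₂} : Set V) =
      weight (fun e => (w e : ℝ)) ω *
        ((ind EX (ω ∩ ↑DB) * q ^ clusterCount (ω ∩ ↑DB) ({h₁, h₂} : Set V)) * (ind EY (ω \ ↑DB) * q ^ clusterCount (ω \ ↑DB) ({h₁, h₂} : Set V))) := by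
  by_cases hω : ω ⊆ ↑DB ∪ ↑DC
  swap
  · obtain ⟨e, heω, heD⟩ := Set.not_subset.1 hω
    have h0 := ApexTwoSum.weight_eq_zero_of_mem_not_mem w hw heω heD
    unfold rcWeightW
    rw [h0]; ring
  have hadd := ApexTwoSum.kT_add hsep hω
  have hpow : q ^ clusterCount ω ({h₁, h₂} : Set V) * q ^ clusterCount (∅ : BondConfig V) ({h₁, h₂} : Set V) = q ^ clusterCount (ω ∩ ↑DB) ({h₁, h₂} : Set V) * q ^ clusterCount (ω \ ↑DB) ({h₁, h₂} : Set V) := by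
    rw [← pow_add, hadd, pow_add]
  by_cases hx : (ω ∩ ↑DB) ∈ EX
  · by_cases hy : (ω \ ↑DB) ∈ EY
    · rw [ind_of_mem hx, ind_of_mem hy, ind_of_mem ((hE ω hω).2 ⟨hx, hy⟩)]
      unfold rcWeightW
      linear_combination (weight (fun e => (w e : ℝ)) ω) * hpow
    · rw [ind_of_mem hx, ind_of_not_mem hy, ind_of_not_mem (fun h => hy ((hE ω hω).1 h).2)]
      ring
  · rw [ind_of_not_mem hx, ind_of_not_mem (fun h => hx ((hE ω hω).1 h).1)]
    ring

include hsep hw hX hX' hY hY' in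
/-- **Wired masses of product events are products.** [this work] -/
theorem wired_sum {E EX EY : Set (BondConfig V)}
    (hE : ∀ ω : BondConfig V, ω ⊆ ↑DB ∪ ↑DC → (ω ∈ E ↔ ((ω ∩ ↑DB) ∈ EX ∧ (ω \ ↑DB) ∈ EY))) :
    (∑ ω : BondConfig V, rcWeightW w q ({h₁, h₂} : Set V) ω * ind E ω) * q ^ clusterCount (∅ : BondConfig V) ({h₁, h₂} : Set V) =
      (∑ η : BondConfig V, rcWeightW wB q ({h₁, h₂} : Set V) η * ind EX η) * (∑ η : BondConfig V, rcWeightW wC q ({h₁, h₂} : Set V) η * ind EY η) := by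
  rw [Finset.sum_mul, Finset.sum_congr rfl fun ω _ => wired_pt hsep w q hw hE ω]
  have e1 := ApexTwoSum.sum_weight_blocks_rc w wB wC (↑DB) hX hX' hY hY' q ({h₁, h₂} : Set V) (fun x => ind EX x) (fun y => ind EY y)
  beta_reduce at e1
  rw [← e1]

include h1b h1c h2b h2c hbc hsep hbC hcB hw hX hX' hY hY' in
/-- **The four wired cells are product events**, hence `K·Z_w(T*) = x_b y_c`, `K·Z_w(U_b*) = x_b y_c'`, `K·Z_w(U_c*) = x_b' y_c`,
`K·Z_w(S*) = x_b' y_c'`. [this work] -/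
theorem wired_cells :
    (∑ ω : BondConfig V, rcWeightW w q ({h₁, h₂} : Set V) ω * ind {η : BondConfig V | (b ∈ cl η.toFinset h₁ ∨ b ∈ cl η.toFinset h₂) ∧ (c ∈ cl η.toFinset h₁ ∨ c ∈ cl η.toFinset h₂)} ω) * q ^ clusterCount (∅ : BondConfig V) ({h₁, h₂} : Set V) = (∑ η : BondConfig V, rcWeightW wB q ({h₁, h₂} : Set V) η * ind {η : BondConfig V | (b ∈ cl η.toFinset h₁ ∨ b ∈ cl η.toFinset h₂)} η) * (∑ η : BondConfig V, rcWeightW wC q ({h₁, h₂} : Set V) η * ind {η : BondConfig V | (c ∈ cl η.toFinset h₁ ∨ c ∈ cl η.toFinset h₂)} η) ∧ (∑ ω : BondConfig V, rcWeightW w q ({h₁, h₂} : Set V) ω * ind {η : BondConfig V | (b ∈ cl η.toFinset h₁ ∨ b ∈ cl η.toFinset h₂) ∧ ¬ (c ∈ cl η.toFinset h₁ ∨ c ∈ cl η.toFinset h₂)} ω) * q ^ clusterCount (∅ : BondConfig V) ({h₁, h₂} : Set V) = (∑ η : BondConfig V, rcWeightW wB q ({h₁, h₂} : Set V) η * ind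 {η : BondConfig V | (b ∈ cl η.toFinset h₁ ∨ b ∈ cl η.toFinset h₂)} η) * (∑ η : BondConfig V, rcWeightW wC q ({h₁, h₂} : Set V) η * ind {η : BondConfig V | ¬ (c ∈ cl η.toFinset h₁ ∨ c ∈ cl η.toFinset h₂)} η) ∧ (∑ ω : BondConfig V, rcWeightW w q ({h₁, h₂} : Set V) ω * ind {η : BondConfig V | ¬ (b ∈ cl η.toFinset h₁ ∨ b ∈ cl η.toFinset h₂) ∧ (c ∈ cl η.toFinset h₁ ∨ c ∈ cl η.toFinset h₂)} ω) * q ^ clusterCount (∅ : BondConfig V) ({h₁, h₂} : Set V) = (∑ η : BondConfig V, rcWeightW wB q ({h₁, h₂} : Set V) η * ind {η : BondConfig V | ¬ (b ∈ cl η.toFinset h₁ ∨ b ∈ cl η.toFinset h₂)} η) * (∑ η : BondConfig V, rcWeightW wC q ({h₁, h₂} : Set V) η * ind {η : BondConfig V | (c ∈ cl η.toFinset h₁ ∨ c ∈ cl η.toFinset h₂)} η) ∧ (∑ ω : BondConfig V, rcWeightW w q ({h₁, h₂} : Set V) ω * ind {η : BondConfig V | ¬ (b ∈ cl η.toFinset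 h₁ ∨ b ∈ cl η.toFinset h₂) ∧ ¬ (c ∈ cl η.toFinset h₁ ∨ c ∈ cl η.toFinset h₂) ∧ Sep (DB ∪ DC) (cl η.toFinset h₁ ∪ cl η.toFinset h₂) b c} ω) * q ^ clusterCount (∅ : BondConfig V) ({h₁, h₂} : Set V) = (∑ η : BondConfig V, rcWeightW wB q ({h₁, h₂} : Set V) η * ind {η : BondConfig V | ¬ (b ∈ cl η.toFinset h₁ ∨ b ∈ cl η.toFinset h₂)} η) * (∑ η : BondConfig V, rcWeightW wC q ({h₁, h₂} : Set V) η * ind {η : BondConfig V | ¬ (c ∈ cl η.toFinset h₁ ∨ c ∈ cl η.toFinset h₂)} η) := by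
  have eb := fun (ω : BondConfig V) (hω : ω ⊆ ↑DB ∪ ↑DC) => glued_bT_iff h1b h2b hsep hbC hω
  have ec := fun (ω : BondConfig V) (hω : ω ⊆ ↑DB ∪ ↑DC) => glued_cT_iff h1c h2c hsep hcB hω
  have es := fun (ω : BondConfig V) => sep_wired h1b h1c h2b h2c hsep hbC hcB hbc ω
  refine ⟨wired_sum hsep w wB wC q hw hX hX' hY hY' fun ω hω => ?_, wired_sum hsep w wB wC q hw hX hX' hY hY' fun ω hω => ?_,
    wired_sum hsep w wB wC q hw hX hX' hY hY' fun ω hω => ?_, wired_sum hsep w wB wC q hw hX hX' hY hY' fun ω hω => ?_⟩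
  · simp only [Set.mem_setOf_eq]; rw [eb ω hω, ec ω hω]; simp only [Set.mem_setOf_eq]
  · simp only [Set.mem_setOf_eq]; rw [eb ω hω, ec ω hω]; simp only [Set.mem_setOf_eq]
  · simp only [Set.mem_setOf_eq]; rw [eb ω hω, ec ω hω]; simp only [Set.mem_setOf_eq]
  · simp only [Set.mem_setOf_eq]; rw [eb ω hω, ec ω hω]; simp only [Set.mem_setOf_eq]
    exact ⟨fun ⟨h1, h2, _⟩ => ⟨h1, h2⟩, fun ⟨h1, h2⟩ => ⟨h1, h2, es ω⟩⟩

/-- `x_b = X_A + X_C + X_D`: the event `b ~ {h₁,h₂}` splits into the arm cells `A, C, D` (pointwise). [this work] -/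
theorem ind_bT_split (t : V) (η : BondConfig V) :
    ind {η : BondConfig V | (t ∈ cl η.toFinset h₁ ∨ t ∈ cl η.toFinset h₂)} η = ind {η : BondConfig V | t ∈ cl η.toFinset h₁ ∧ h₂ ∈ cl η.toFinset h₁} η + ind {η : BondConfig V | t ∈ cl η.toFinset h₁ ∧ h₂ ∉ cl η.toFinset h₁} η + ind {η : BondConfig V | t ∉ cl η.toFinset h₁ ∧ h₂ ∉ cl η.toFinset h₁ ∧ h₂ ∈ cl η.toFinset t} η := by
  by_cases c1 : t ∈ cl η.toFinset h₁
  · have hT : η ∈ {η : BondConfig V | (t ∈ cl η.toFinset h₁ ∨ t ∈ cl η.toFinset h₂)} := Or.inl c1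
    have nD : η ∉ {η : BondConfig V | t ∉ cl η.toFinset h₁ ∧ h₂ ∉ cl η.toFinset h₁ ∧ h₂ ∈ cl η.toFinset t} := fun h => h.1 c1
    by_cases c2 : h₂ ∈ cl η.toFinset h₁
    · have hA : η ∈ {η : BondConfig V | t ∈ cl η.toFinset h₁ ∧ h₂ ∈ cl η.toFinset h₁} := ⟨c1, c2⟩
      have nC : η ∉ {η : BondConfig V | t ∈ cl η.toFinset h₁ ∧ h₂ ∉ cl η.toFinset h₁} := fun h => h.2 c2
      rw [ind_of_mem hT, ind_of_mem hA, ind_of_not_mem nC, ind_of_not_mem nD]; ring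
    · have nA : η ∉ {η : BondConfig V | t ∈ cl η.toFinset h₁ ∧ h₂ ∈ cl η.toFinset h₁} := fun h => c2 h.2
      have hC : η ∈ {η : BondConfig V | t ∈ cl η.toFinset h₁ ∧ h₂ ∉ cl η.toFinset h₁} := ⟨c1, c2⟩
      rw [ind_of_mem hT, ind_of_not_mem nA, ind_of_mem hC, ind_of_not_mem nD]; ring
  · have nA : η ∉ {η : BondConfig V | t ∈ cl η.toFinset h₁ ∧ h₂ ∈ cl η.toFinset h₁} := fun h => c1 h.1
    have nC : η ∉ {η : BondConfig V | t ∈ cl η.toFinset h₁ ∧ h₂ ∉ cl η.toFinset h₁} := fun h => c1 h.1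
    by_cases c3 : h₂ ∈ cl η.toFinset t
    · have c2 : h₂ ∉ cl η.toFinset h₁ := fun h => c1 (mem_cl_trans h (mem_cl_comm.1 c3))
      have hT : η ∈ {η : BondConfig V | (t ∈ cl η.toFinset h₁ ∨ t ∈ cl η.toFinset h₂)} := Or.inr (mem_cl_comm.1 c3)
      have hD : η ∈ {η : BondConfig V | t ∉ cl η.toFinset h₁ ∧ h₂ ∉ cl η.toFinset h₁ ∧ h₂ ∈ cl η.toFinset t} := ⟨c1, c2, c3⟩
      rw [ind_of_mem hT, ind_of_not_mem nA, ind_of_not_mem nC, ind_of_mem hD]; ring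
    · have nT : η ∉ {η : BondConfig V | (t ∈ cl η.toFinset h₁ ∨ t ∈ cl η.toFinset h₂)} :=
        fun h => h.elim c1 (fun h' => c3 (mem_cl_comm.1 h'))
      have nD : η ∉ {η : BondConfig V | t ∉ cl η.toFinset h₁ ∧ h₂ ∉ cl η.toFinset h₁ ∧ h₂ ∈ cl η.toFinset t} := fun h => c3 h.2.2
      rw [ind_of_not_mem nT, ind_of_not_mem nA, ind_of_not_mem nC, ind_of_not_mem nD]; ring

/-- `x_b' = X_B + X_E`: the event `b ≁ {h₁,h₂}` splits into the arm cells `B, E` (pointwise). [this work] -/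
theorem ind_bT'_split (t : V) (η : BondConfig V) :
    ind {η : BondConfig V | ¬ (t ∈ cl η.toFinset h₁ ∨ t ∈ cl η.toFinset h₂)} η = ind {η : BondConfig V | t ∉ cl η.toFinset h₁ ∧ h₂ ∈ cl η.toFinset h₁} η + ind {η : BondConfig V | t ∉ cl η.toFinset h₁ ∧ h₂ ∉ cl η.toFinset h₁ ∧ h₂ ∉ cl η.toFinset t} η := by
  by_cases c1 : t ∈ cl η.toFinset h₁
  · have nT : η ∉ {η : BondConfig V | ¬ (t ∈ cl η.toFinset h₁ ∨ t ∈ cl η.toFinset h₂)} := fun h => h (Or.inl c1)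
    have nB : η ∉ {η : BondConfig V | t ∉ cl η.toFinset h₁ ∧ h₂ ∈ cl η.toFinset h₁} := fun h => h.1 c1
    have nE : η ∉ {η : BondConfig V | t ∉ cl η.toFinset h₁ ∧ h₂ ∉ cl η.toFinset h₁ ∧ h₂ ∉ cl η.toFinset t} := fun h => h.1 c1
    rw [ind_of_not_mem nT, ind_of_not_mem nB, ind_of_not_mem nE]; ring
  · by_cases c3 : h₂ ∈ cl η.toFinset t
    · have nT : η ∉ {η : BondConfig V | ¬ (t ∈ cl η.toFinset h₁ ∨ t ∈ cl η.toFinset h₂)} :=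
        fun h => h (Or.inr (mem_cl_comm.1 c3))
      have nB : η ∉ {η : BondConfig V | t ∉ cl η.toFinset h₁ ∧ h₂ ∈ cl η.toFinset h₁} := fun h => c1 (mem_cl_trans h.2 (mem_cl_comm.1 c3))
      have nE : η ∉ {η : BondConfig V | t ∉ cl η.toFinset h₁ ∧ h₂ ∉ cl η.toFinset h₁ ∧ h₂ ∉ cl η.toFinset t} := fun h => h.2.2 c3
      rw [ind_of_not_mem nT, ind_of_not_mem nB, ind_of_not_mem nE]; ring
    · have hT : η ∈ {η : BondConfig V | ¬ (t ∈ cl η.toFinset h₁ ∨ t ∈ cl η.toFinset h₂)} :=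
        fun h => h.elim c1 (fun h' => c3 (mem_cl_comm.1 h'))
      by_cases c2 : h₂ ∈ cl η.toFinset h₁
      · have hB : η ∈ {η : BondConfig V | t ∉ cl η.toFinset h₁ ∧ h₂ ∈ cl η.toFinset h₁} := ⟨c1, c2⟩
        have nE : η ∉ {η : BondConfig V | t ∉ cl η.toFinset h₁ ∧ h₂ ∉ cl η.toFinset h₁ ∧ h₂ ∉ cl η.toFinset t} := fun h => h.2.1 c2
        rw [ind_of_mem hT, ind_of_mem hB, ind_of_not_mem nE]; ring
      · have nB : η ∉ {η : BondConfig V | t ∉ cl η.toFinset h₁ ∧ h₂ ∈ cl η.toFinset h₁} := fun h => c2 h.2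
        have hE : η ∈ {η : BondConfig V | t ∉ cl η.toFinset h₁ ∧ h₂ ∉ cl η.toFinset h₁ ∧ h₂ ∉ cl η.toFinset t} := ⟨c1, c2, c3⟩
        rw [ind_of_mem hT, ind_of_not_mem nB, ind_of_mem hE]; ring

/-- Sum form of the splits. [this work] -/
theorem xT_split (u : Sym2 V → unitInterval) (t : V) :
    (∑ η : BondConfig V, rcWeightW u q ({h₁, h₂} : Set V) η * ind {η : BondConfig V | (t ∈ cl η.toFinset h₁ ∨ t ∈ cl η.toFinset h₂)} η) =
      (∑ η : BondConfig V, rcWeightW u q ({h₁, h₂} : Set V) η * ind {η : BondConfig V | t ∈ cl η.toFinset h₁ ∧ h₂ ∈ cl η.toFinset h₁} η) + (∑ η : BondConfig V, rcWeightW u q ({h₁, h₂} : Set V) η * ind {η : BondConfig V | t ∈ cl η.toFinset h₁ ∧ h₂ ∉ cl η.toFinset h₁} η) +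
        (∑ η : BondConfig V, rcWeightW u q ({h₁, h₂} : Set V) η * ind {η : BondConfig V | t ∉ cl η.toFinset h₁ ∧ h₂ ∉ cl η.toFinset h₁ ∧ h₂ ∈ cl η.toFinset t} η) := by
  rw [← Finset.sum_add_distrib, ← Finset.sum_add_distrib]
  exact Finset.sum_congr rfl fun η _ => by rw [ind_bT_split]; ring

/-- Sum form of the splits. [this work] -/
theorem xT'_split (u : Sym2 V → unitInterval) (t : V) :
    (∑ η : BondConfig V, rcWeightW u q ({h₁, h₂} : Set V) η * ind {η : BondConfig V | ¬ (t ∈ cl η.toFinset h₁ ∨ t ∈ cl η.toFinset h₂)} η) =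
      (∑ η : BondConfig V, rcWeightW u q ({h₁, h₂} : Set V) η * ind {η : BondConfig V | t ∉ cl η.toFinset h₁ ∧ h₂ ∈ cl η.toFinset h₁} η) + (∑ η : BondConfig V, rcWeightW u q ({h₁, h₂} : Set V) η * ind {η : BondConfig V | t ∉ cl η.toFinset h₁ ∧ h₂ ∉ cl η.toFinset h₁ ∧ h₂ ∉ cl η.toFinset t} η) := by
  rw [← Finset.sum_add_distrib]
  exact Finset.sum_congr rfl fun η _ => by rw [ind_bT'_split]; ring

end WiredSums

end ThetaFar

end Summit.CriticalPhenomena.PercolationContinuityZ3.Theorems
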